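import Summits.Parity.GeneralizedHardyLittlewood.Theses.ZDegreeToeplitzBand
import Literature.NumberTheory.LFunctions.Zhang2022.KnifeEdgeLenZDegreePsiOn

/-!
# Route `ZDegreeToeplitzBand` — glue item `PsiGradedTablesOfClasses` (stmt-Parity-20447), closed

D-0014 CLASS CALL (a+b) of 2026-08-27 (tenure planner ls-knife-plan g0; HOME/knife/CLASS-CALL.md v1.2,
route rev 3 193bb1b556da) split the EXISTENCE crux K1 `PsiGradedTables` (stmt-Parity-20014) along the census
edge C′ = `KnifeEdge.ShortPairs` (total log-length `< 1`) into three children: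

* `ShortPairsCrossDegOne` (stmt-Parity-20444): a pair functional `X₁` with the degree-1 ψ-graded cross table ON
  short pairs, eventually in `c′` (`KnifeEdge.CrossTablePsiOn c′ ShortPairs 1 X₁`);
* `ShortPairsDualDegOne` (stmt-Parity-20445): a pair functional `Y₁` with the degree-1 ψ-graded dual table ON
  short pairs (`KnifeEdge.DualCrossTablePsiOn c′ ShortPairs 1 Y₁`);
* `LongPairsGradedTables` (stmt-Parity-20446, the full-class remainder 𝒳₂, HELD): the two degree-1 tables on
  the NON-short in-class pairs and the degree-2 table `KnifeEdge.TauTwoTablePsi c′ X₂` on all in-class pairs;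

with the generated glue item `PsiGradedTablesOfClasses := ShortPairsCrossDegOne → ShortPairsDualDegOne →
LongPairsGradedTables → PsiGradedTables` (stmt-Parity-20447). This file lands the planner's glue proof VERBATIM
(`psiGradedTables_of_split`, classcall/Sketch.lean sha16 796308d61ff6dd96 = evidence on the item; re-checked
against the landed route file as classcall/SketchProofs.lean sha16 59e4e9811261f6d6): take `c′ ≥` the max of
the three thresholds; piecewise functionals `X₁ := fun f f′ g g′ => if ShortPairs f f′ g g′ then X₁ˢ f f′ g g′
else X₁ᴸ f f′ g g′` (classical `if`), likewise `Y₁`, and `X₂` from the long child; each table splits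
pointwise in the pair (`by_cases` on `ShortPairs` + `simpa [hs]`). Pure logic over tree theorems (typer-1's
`KnifeEdgeLenZDegreePsiOn`, p516582); standard axioms only. Cell landau-siegel §D, ls-knife-typer-3 g11
(prover hand asked by ls-knife-plan g0, INBOX 2026-08-27T11:44:59Z / 11:46:55Z; the K2 twin
`PsiGradedTablesCloseOfShort` is `Theorems/ZDegreeToeplitzBandPsiGradedTablesCloseOfShort.lean`, p529406).

«The programme SEARCHES and TYPES; no claim about Landau–Siegel zeros, Theorems 1–2 of
arXiv:2211.02515 or a repaired Margin232 until a kernel theorem says so.»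

## References

* [Zhang2022LandauSiegel] Y. Zhang, Discrete mean estimates and the Landau–Siegel zero, arXiv:2211.02515v1
  (2022): §2 (2.16)–(2.17), §8 Lemma 8.1 / (8.5) (the discrete means the ψ-graded tables evaluate).
-/

namespace Summit.Parity.GeneralizedHardyLittlewood.Theorems

open Literature.NumberTheory.LFunctions.Zhang2022
open Literature.NumberTheory.LFunctions.Zhang2022.KnifeEdge
open Literature.NumberTheory.LFunctions.Zhang2022.Skeleton
open Summit.Parity.GeneralizedHardyLittlewood.Theses.ZDegreeToeplitzBand

/-- **GLUE for K1** (planner's `psiGradedTables_of_split`, verbatim): piecewise functionals — on a short pair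
use the short child's functional, elsewhere the long child's; `X₂` comes from the long child whole. So
`ShortPairsCrossDegOne`, `ShortPairsDualDegOne` and `LongPairsGradedTables` give the parent `PsiGradedTables`.
[cite: Zhang2022LandauSiegel, §8 Lemma 8.1 / (8.5)] -/
theorem psiGradedTables_of_split (hX : ShortPairsCrossDegOne) (hY : ShortPairsDualDegOne)
    (hB : LongPairsGradedTables) : PsiGradedTables := by
  classical
  obtain ⟨c₁, h₁⟩ := hX
  obtain ⟨c₁', h₁'⟩ := hY
  obtain ⟨c₂, h₂⟩ := hB
  refine ⟨max (max c₁ c₁') c₂, fun c' hc' => ?_⟩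
  obtain ⟨Xs, hXs⟩ := h₁ c' (le_trans (le_trans (le_max_left _ _) (le_max_left _ _)) hc')
  obtain ⟨Ys, hYs⟩ := h₁' c' (le_trans (le_trans (le_max_right _ _) (le_max_left _ _)) hc')
  obtain ⟨Xl, Yl, X₂, hXl, hYl, hX₂⟩ := h₂ c' (le_trans (le_max_right _ _) hc')
  refine ⟨fun f f' g g' => if ShortPairs f f' g g' then Xs f f' g g' else Xl f f' g g',
    fun f f' g g' => if ShortPairs f f' g g' then Ys f f' g g' else Yl f f' g g', X₂, ?_, ?_, hX₂⟩
  · intro f f' g g' hf hg ε hε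
    by_cases hs : ShortPairs f f' g g'
    · simpa [hs] using hXs f f' g g' hf hg hs ε hε
    · simpa [hs] using hXl f f' g g' hf hg hs ε hε
  · intro g₁ g₁' g₂ g₂' hg₁ hg₂ ε hε
    by_cases hs : ShortPairs g₁ g₁' g₂ g₂'
    · simpa [hs] using hYs g₁ g₁' g₂ g₂' hg₁ hg₂ hs ε hε
    · simpa [hs] using hYl g₁ g₁' g₂ g₂' hg₁ hg₂ hs ε hε

/-- **Glue item `PsiGradedTablesOfClasses`** of route `ZDegreeToeplitzBand` (stmt-Parity-20447):
`ShortPairsCrossDegOne → ShortPairsDualDegOne → LongPairsGradedTables → PsiGradedTables` holds, by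
`psiGradedTables_of_split`. [cite: Zhang2022LandauSiegel, §8 Lemma 8.1 / (8.5)] -/
theorem psiGradedTablesOfClasses_proof :
    Summit.Parity.GeneralizedHardyLittlewood.Theses.ZDegreeToeplitzBand.PsiGradedTablesOfClasses := by
  unfold Summit.Parity.GeneralizedHardyLittlewood.Theses.ZDegreeToeplitzBand.PsiGradedTablesOfClasses
  intro hX hY hB
  exact psiGradedTables_of_split hX hY hB

end Summit.Parity.GeneralizedHardyLittlewood.Theorems
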